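import Mathlib
import HarnessLib
import Summits.Langlands.Statement
import Summits.Langlands.Langlands.Theses.MonodromyDichotomy
import Summits.Langlands.Langlands.Theses.HolomorphicLimitSplit
import Summits.Langlands.Langlands.Theorems.MonodromyDichotomyLieIrreducibleAutomorphyOfResplit

set_option linter.dupNamespace false

/-!
# MonodromyDichotomyKroneckerPrimitivity — statement-and-kernel support module (tree twin of the decomp-langlands lens-2 gen-12 node `KroneckerPrimitivitySplit`; `--supports stmt-Langlands-31222`)

The node header follows verbatim.  KroneckerPrimitivitySplit — decomp-langlands lens-2 gen 12 (structural dichotomy «special vs generic», RESIDUAL MODE, BLOCKER FIRST)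

TARGET (a LAYER-2 declared core of the cell, by name): H = `MonodromyDichotomy.HigherLieRankAutomorphy`
(stmt-Langlands-31222, crux rank 204, OPEN; child 4/4 of the gen-4 resplit of G = `MonodromyDichotomy.LieIrreducibleAutomorphy`
stmt-Langlands-25617 on route-Langlands-MonodromyDichotomy rev 3; glue `LieIrreducibleAutomorphy_of_resplit` 31223 CLOSED by
`Theorems.LieIrreducibleAutomorphy_of_resplit_proof`).  H = clause (B) in rank-induction form for the irreducible pinned-geometric
LIE-IRREDUCIBLE ρ of rank n ≥ 3 WITHOUT progression spectra near 1 (semisimple Lie rank ≥ 2: (G°)^der ∉ {image of SL₂ under Sym^{n-1}}).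

THESIS (lens 2 = special STRUCTURE vs GENERIC, read on the Lie type of the derived monodromy group (G°)^der ⊂ SL_n):
«(G°)^der is either NON-SIMPLE modulo centre — then ρ is a KRONECKER PRODUCT ρ|_E ≅ ρ₁ ⊗ ρ₂ of two LIE factors of ranks a, b ≥ 2
(ab = n) over a finite extension E/K, which by Tate–Patrikis lifting (Patrikis, Variations on a theorem of Tate, Mem. AMS 2019) and the
factor-permutation field can be taken SOLVABLE GALOIS whenever the isotypic simple factors are permuted through a solvable group (always for
n < 32) — or SIMPLE (the generic, tensor-primitive bulk: SL_m, Sp, SO, spin, exceptional images).»  On the special side clause (B) IS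
TENSOR-PRODUCT FUNCTORIALITY GL_a × GL_b → GL_ab (given the rank induction for the two Lie factors): a THEOREM exactly on the boxes
(a,b) ∈ {(2,2),(2,3),(3,2)} over every number field (Ramakrishnan 2000 Thm M = tree fact `Ramakrishnan2000_theoremM` incl. the cuspidality
criterion; Kim–Shahidi 2002 Thm A = tree fact `KimShahidi2002_functorialProduct_GL2GL3`; the family `WeakTensorProductFunctoriality a b` is the
tree's own name for the text, OPEN at every other box, Getz–Hahn 2024 Thm 13.6.2), i.e. exactly for n < 8.

    H ⟸ KT_low `LowRankKroneckerTransport`  [NEW · crux 2 · WEAKER · ATTACKABLE-NOW / CLOSABLE MOD PRINT: K-rational Kronecker ρ of rank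
           3 ≤ n < 8 (⇒ (a,b) ∈ {(2,2),(2,3),(3,2)}, certificate `kronecker_boxes_lt_eight`) — rank-IH automorphy of the two Lie factors +
           `Ramakrishnan2000_theoremM` / `KimShahidi2002_functorialProduct_GL2GL3` + cuspidality of π₁ ⊠ π₂ from Lie-irreducibility of ρ
           (Ramakrishnan's criterion (C) is in the tree; GL₂×GL₃: Ramakrishnan–Wang 2004 criterion, typer-sized) + L-algebraicity of ⊠
           (archimedean clause of Thm M / Thm A, typer-sized); NO descent, NO lifting problem: the factors are given over K itself]
      ∧  KT_high `HigherKroneckerTransport` [NEW · crux 3 · WEAKER · IDEA-NEEDED / BARRIER: K-rational Kronecker ρ of rank n ≥ 8 — tensor-product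
           functoriality GL_a × GL_b → GL_ab for ab ≥ 8 is OPEN (beyond Rankin–Selberg converse theorems and beyond twisted endoscopy:
           `TwistedEndoscopySelfDualBarrier` head-on for the generic non-self-dual product); UNDECIDED]
      ∧  PRIM `SolvablyTensorPrimitiveAutomorphy` [NEW · crux 4 · WEAKER · DECLARED RESIDUAL · UNDECIDED: the H-instances admitting NO Kronecker
           structure with Lie factors over ANY solvable Galois E/K on which ρ|_E stays in the H-box = (G°)^der SIMPLE (mod Tate–Patrikis) plus,
           from n ≥ 32 on, isotypic-factor types permuted through a non-solvable group (correctly residual: non-solvable base change is open,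
           `SolvableImageBarrier`) — a STRICTLY SMALLER box than H, not known to imply H (the complement needs the open functoriality of KT_high)]
      ∧  CSD `CliffordSolvableDescent` [DEDUP-ATTACH of `HolomorphicLimitSplit.CliffordSolvableDescent` stmt-Langlands-31695 (support, PRINT mod
           W⁺: Arthur–Clozel III.4.2(b) + SMO + Clifford + AI; lens-3-g7, CLEARED row 89) — does the solvable descent ONCE, in the kernel]
      ∧  W⁺ `MonodromyDichotomy.SatakeAvatarExistence` [DEDUP-ATTACH of host item stmt-Langlands-17415 (crux, OPEN, N0 core)]
      ∧  FRAME `HigherLieRankFrame := H → Langlands` [support · imported complement = the HOST ROUTE below H, certified `frame_of_host`]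

EXACTNESS: H ⟹ KT_low ∧ KT_high ∧ PRIM outright (`cells_of_higherLieRank`: every cell is H with one extra hypothesis); KT_low → KT_high →
PRIM → H modulo (W⁺ ∧ CSD) (`higherLieRank_of_cells`: excluded middle on the SOLVABLE Kronecker dial; on the Kronecker side KT is run over
E on ρ|_E and the weak automorphy is descended E → K by CSD fed with W⁺ — the row-6/48 orbit rule: the dial is SATURATED along the print
transfer groupoid {⊗χ, restriction to solvable Galois E, descent given W⁺}, so no kernel-closable instance is booked in the residual; bus
L772 F2 shape).  Langlands ⟺ (KT_low ∧ KT_high ∧ PRIM) ∧ CSD ∧ W⁺ ∧ FRAME (`langlands_iff_pieces`, EXACT mod NOTHING at route level).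
COSTUME census: 0 EQUIV pieces (probes: no cell, and no cell-with-one-binder-dropped, gives H or Langlands by the batteries); every NEW
piece WEAKER (implied by Langlands: `…_of_langlands`); FRAME/CSD/W⁺ are host/tree items by name or verbatim.
WHY NOVEL (cell-relative): no node or route of record cuts a (B)-box by the SIMPLICITY of (G°)^der / tensor-decomposability into two LIE
factors — MonodromyDichotomy's own S2/T are ARTIN–Kronecker (one factor of finite image; H is by construction the box with no Artin factor),
LieTypeCarving C₂/C₃ are Lie-isotypic-with-projective-Artin multiplicity and Lie-IMPRIMITIVE (induced) transport, PolarisationCarving is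
duality, LieRankDichotomy (g3) is rank 1 vs ≥ 2, lens-4-g13's TP `KroneckerCompanionCell` lives on the COMPANION box R 33380 where
companionship is ⊗-closed (closed outright mod IH) — here the special side is FUNCTORIALITY with its print frontier ab ≤ 6 made a
closable item and its open part (ab ≥ 8) a separately typed crux; the residual «solvably tensor-primitive Lie type» is new.
-/


namespace Summit.Langlands.Langlands.Theorems.MonodromyDichotomyKroneckerPrimitivity

open Summit.Langlands.Langlands.Theses

open scoped BigOperators Classical Matrix

/-! ## 1. Vocabulary (structured forms; the items below inline them VERBATIM — `Iff.rfl` bridges in §6) -/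
section Vocabulary
variable {K : Type} [Field K] [NumberField K] {ℓ : ℕ} [Fact ℓ.Prime] {n : ℕ}

/-- pinned-geometric: a.e. unramified and de Rham at v ∣ ℓ for Fontaine's pinned admissible datum (H's clause, verbatim shape). -/
def PinnedGeometric (ρ : Literature.NumberTheory.GaloisRepresentations.FramedGaloisRep K (PadicAlgCl ℓ) n) : Prop :=
  ((∀ᶠ v : IsDedekindDomain.HeightOneSpectrum (NumberField.RingOfIntegers K) in Filter.cofinite, ρ.IsUnramifiedAt v) ∧ ∀ (v : IsDedekindDomain.HeightOneSpectrum (NumberField.RingOfIntegers K)) (hv : ((ℓ : ℕ) : NumberField.RingOfIntegers K) ∈ v.asIdeal), (Literature.NumberTheory.PAdicHodge.fontainePstAdicCompletion v ℓ hv).IsDeRhamFramed (ρ.toLocal v))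

/-- Lie-irreducible: irreducible on every finite-index subgroup Γ_L (H's clause). -/
def IsLieIrreducible (ρ : Literature.NumberTheory.GaloisRepresentations.FramedGaloisRep K (PadicAlgCl ℓ) n) : Prop :=
  (∀ (L : Type) [Field L] [NumberField L] [Algebra K L], (ρ.restrictField L).toGaloisRep.IsIrreducible)

/-- progression spectra near 1 (H's NEGATED clause: semisimple Lie rank 1, the symmetric-power line). -/
def HasProgressionSpectra (ρ : Literature.NumberTheory.GaloisRepresentations.FramedGaloisRep K (PadicAlgCl ℓ) n) : Prop :=
  (∃ U : Set (Field.absoluteGaloisGroup K), IsOpen U ∧ (1 : Field.absoluteGaloisGroup K) ∈ U ∧ ∀ g ∈ U, ∃ c r : PadicAlgCl ℓ, Literature.NumberTheory.GaloisRepresentations.FramedRep.charpoly ρ g = ∏ j ∈ Finset.range n, (Polynomial.X - Polynomial.C (c * r ^ j)))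

/-- the H-BOX: irreducible ∧ pinned-geometric ∧ Lie-irreducible ∧ no progression spectra. -/
def InHigherLieRankBox (ρ : Literature.NumberTheory.GaloisRepresentations.FramedGaloisRep K (PadicAlgCl ℓ) n) : Prop :=
  ρ.toGaloisRep.IsIrreducible ∧ PinnedGeometric ρ ∧ IsLieIrreducible ρ ∧ ¬ HasProgressionSpectra ρ

/-- a LIE FACTOR: irreducible, pinned-geometric, Lie-irreducible (the hypotheses the rank-IH of H asks of a lower-rank σ). -/
def IsLieFactor {a : ℕ} (ρ₁ : Literature.NumberTheory.GaloisRepresentations.FramedGaloisRep K (PadicAlgCl ℓ) a) : Prop :=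
  ρ₁.toGaloisRep.IsIrreducible ∧ PinnedGeometric ρ₁ ∧ IsLieIrreducible ρ₁

/-- THE DIAL over K itself — K-RATIONAL KRONECKER STRUCTURE: charpoly ρ(g) = charpoly(ρ₁(g) ⊗ ρ₂(g)) on Γ_K for two Lie factors of ranks
a, b ≥ 2 with ab = n (the tree's Kronecker rendering of `MonodromyDichotomy.StructuredTransport` / `CliffordTateStructure`, with the Artin
factor replaced by a second LIE factor).  By Brauer–Nesbitt this is ρ ≅ ρ₁ ⊗ ρ₂ (ρ irreducible). -/
def IsRationalKronecker (ρ : Literature.NumberTheory.GaloisRepresentations.FramedGaloisRep K (PadicAlgCl ℓ) n) : Prop :=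
  ∃ (a b : ℕ) (ρ₁ : Literature.NumberTheory.GaloisRepresentations.FramedGaloisRep K (PadicAlgCl ℓ) a) (ρ₂ : Literature.NumberTheory.GaloisRepresentations.FramedGaloisRep K (PadicAlgCl ℓ) b), 2 ≤ a ∧ 2 ≤ b ∧ n = a * b ∧
    IsLieFactor ρ₁ ∧ IsLieFactor ρ₂ ∧ ∀ g : Field.absoluteGaloisGroup K, Literature.NumberTheory.GaloisRepresentations.FramedRep.charpoly ρ g =
      (Matrix.kroneckerMap (· * ·) ((ρ₁ g : GL (Fin a) (PadicAlgCl ℓ)) : Matrix (Fin a) (Fin a) (PadicAlgCl ℓ))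
        ((ρ₂ g : GL (Fin b) (PadicAlgCl ℓ)) : Matrix (Fin b) (Fin b) (PadicAlgCl ℓ))).charpoly

/-- THE SATURATED DIAL — SOLVABLY KRONECKER: over some solvable Galois E/K the restriction ρ|_E is (still in the H-box over E and) E-rationally
Kronecker.  On paper = «(G°)^der non-simple mod centre with the isotypic simple factors permuted through a solvable group» (Tate–Patrikis
geometric lifting over a CM quadratic extension of the clump-fixing field); closed under ⊗χ, under restriction to solvable Galois L among
in-box restrictions, and under descent (row-6/48 orbit audit in the memo §5). -/
def IsSolvablyKronecker (ρ : Literature.NumberTheory.GaloisRepresentations.FramedGaloisRep K (PadicAlgCl ℓ) n) : Prop :=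
  ∃ (E : Type) (_ : Field E) (_ : NumberField E) (_ : Algebra K E), IsGalois K E ∧ IsSolvable (E ≃ₐ[K] E) ∧
    InHigherLieRankBox (ρ.restrictField E) ∧ IsRationalKronecker (ρ.restrictField E)

/-- weak automorphy of (ρ, ι) at compact-level witness hcpt (H's conclusion). -/
def WeakAutomorphic (hcpt : Literature.NumberTheory.Automorphic.isCompact_glFiniteIntegralLevel n K) (ι : PadicAlgCl ℓ ≃+* ℂ) (ρ : Literature.NumberTheory.GaloisRepresentations.FramedGaloisRep K (PadicAlgCl ℓ) n) : Prop :=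
  ∃ π : Literature.NumberTheory.Automorphic.CuspidalAutomorphicRepData n K hcpt, π.1.IsLAlgebraic ∧ ∀ᶠ v : IsDedekindDomain.HeightOneSpectrum (NumberField.RingOfIntegers K) in Filter.cofinite, SatakeFrobCompatibleAt ι π.1 ρ v

end Vocabulary

/-- the RANK INDUCTION HYPOTHESIS H carries (Lie-irreducible automorphy in every rank 2 ≤ m < n over every number field), verbatim. -/
def RankIH (n : ℕ) : Prop :=
  (∀ (m : ℕ), 2 ≤ m → m < n → ∀ (E : Type) [Field E] [NumberField E] (hE : Literature.NumberTheory.Automorphic.isCompact_glFiniteIntegralLevel m E) (ℓ' : ℕ) [Fact ℓ'.Prime] (ι' : PadicAlgCl ℓ' ≃+* ℂ) (σ : Literature.NumberTheory.GaloisRepresentations.FramedGaloisRep E (PadicAlgCl ℓ') m), σ.toGaloisRep.IsIrreducible → ((∀ᶠ v : IsDedekindDomain.HeightOneSpectrum (NumberField.RingOfIntegers E) in Filter.cofinite, σ.IsUnramifiedAt v) ∧ ∀ (v : IsDedekindDomain.HeightOneSpectrum (NumberField.RingOfIntegers E)) (hv : ((ℓ' : ℕ) : NumberField.RingOfIntegers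 E) ∈ v.asIdeal), (Literature.NumberTheory.PAdicHodge.fontainePstAdicCompletion v ℓ' hv).IsDeRhamFramed (σ.toLocal v)) → (∀ (L : Type) [Field L] [NumberField L] [Algebra E L], (σ.restrictField L).toGaloisRep.IsIrreducible) → ∃ π : Literature.NumberTheory.Automorphic.CuspidalAutomorphicRepData m E hE, π.1.IsLAlgebraic ∧ ∀ᶠ v : IsDedekindDomain.HeightOneSpectrum (NumberField.RingOfIntegers E) in Filter.cofinite, SatakeFrobCompatibleAt ι' π.1 σ v)

/-! ## 2. Certificates (kernel-checked arithmetic of the cut) -/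
section Certificates

/-- the rank dial of the Kronecker side is exhaustive and exclusive. -/
theorem rank_threshold (n : ℕ) : (n < 8 ∨ 8 ≤ n) ∧ ¬ (n < 8 ∧ 8 ≤ n) := by omega

/-- **KT_low IS THE PRINT FRONTIER**: a Kronecker box (a,b) with a, b ≥ 2 and 3 ≤ ab < 8 is (2,2), (2,3) or (3,2) — exactly the boxes where
`WeakTensorProductFunctoriality a b` is a theorem (Ramakrishnan 2000; Kim–Shahidi 2002). -/
theorem kronecker_boxes_lt_eight (n a b : ℕ) (h3 : 3 ≤ n) (h8 : n < 8) (hab : n = a * b) (ha : 2 ≤ a) (hb : 2 ≤ b) :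
    (a = 2 ∧ b = 2) ∨ (a = 2 ∧ b = 3) ∨ (a = 3 ∧ b = 2) := by
  subst hab
  have ha' : a ≤ 3 := by nlinarith
  have hb' : b ≤ 3 := by nlinarith
  interval_cases a <;> interval_cases b <;> omega

/-- the first OPEN Kronecker boxes: rank 8 = 2·4 and rank 9 = 3·3 are composite with both factors ≥ 2 (KT_high is not vacuous). -/
theorem kronecker_boxes_ge_eight : (8 = 2 * 4 ∧ 2 ≤ 2 ∧ 2 ≤ 4) ∧ (9 = 3 * 3 ∧ 2 ≤ 3) := by omega

/-- prime ranks carry no Kronecker box (there KT_low / KT_high are vacuous and the whole H-box is PRIM): e.g. n ∈ {3,5,7}. -/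
theorem no_kronecker_box_of_prime (n a b : ℕ) (hp : n.Prime) (hab : n = a * b) (ha : 2 ≤ a) (hb : 2 ≤ b) : False := by
  subst hab
  rcases hp.eq_one_or_self_of_dvd a (Dvd.intro b rfl) with h | h
  · omega
  · have : b = 1 := by
      have hpos : 0 < a := by omega
      have := h; nlinarith [this]
    omega

end Certificates

/-! ## 3. The target BY NAME and its text (identity certified by `Iff.rfl`) -/

/-- H in structured form. -/
theorem target_iff : MonodromyDichotomy.HigherLieRankAutomorphy ↔
    ∀ (K : Type) [Field K] [NumberField K] (n : ℕ) (hcpt : Literature.NumberTheory.Automorphic.isCompact_glFiniteIntegralLevel n K), 3 ≤ n → RankIH n →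
      ∀ (ℓ : ℕ) [Fact ℓ.Prime] (ι : PadicAlgCl ℓ ≃+* ℂ) (ρ : Literature.NumberTheory.GaloisRepresentations.FramedGaloisRep K (PadicAlgCl ℓ) n), ρ.toGaloisRep.IsIrreducible → PinnedGeometric ρ →
        IsLieIrreducible ρ → ¬ HasProgressionSpectra ρ → WeakAutomorphic hcpt ι ρ := Iff.rfl

/-- H's tree text (route-Langlands-MonodromyDichotomy rev 3, 2253 chars) — the cells below are this text with ONE inserted hypothesis each. -/
theorem target_text_iff : MonodromyDichotomy.HigherLieRankAutomorphy ↔ ∀ (K : Type) [Field K] [NumberField K] (n : ℕ) (hcpt : Literature.NumberTheory.Automorphic.isCompact_glFiniteIntegralLevel n K), 3 ≤ n → (∀ (m : ℕ), 2 ≤ m → m < n → ∀ (E : Type) [Field E] [NumberField E] (hE : Literature.NumberTheory.Automorphic.isCompact_glFiniteIntegralLevel m E) (ℓ' : ℕ) [Fact ℓ'.Prime] (ι' : PadicAlgCl ℓ' ≃+* ℂ) (σ : Literature.NumberTheory.GaloisRepresentations.FramedGaloisRep E (PadicAlgCl ℓ') m), σ.toGaloisRep.IsIrreducible → ((∀ᶠ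 v : IsDedekindDomain.HeightOneSpectrum (NumberField.RingOfIntegers E) in Filter.cofinite, σ.IsUnramifiedAt v) ∧ ∀ (v : IsDedekindDomain.HeightOneSpectrum (NumberField.RingOfIntegers E)) (hv : ((ℓ' : ℕ) : NumberField.RingOfIntegers E) ∈ v.asIdeal), (Literature.NumberTheory.PAdicHodge.fontainePstAdicCompletion v ℓ' hv).IsDeRhamFramed (σ.toLocal v)) → (∀ (L : Type) [Field L] [NumberField L] [Algebra E L], (σ.restrictField L).toGaloisRep.IsIrreducible) → ∃ π : Literature.NumberTheory.Automorphic.CuspidalAutomorphicRepData m E hE, π.1.IsLAlgebraic ∧ ∀ᶠ v : IsDedekindDomain.HeightOneSpectrum (NumberField.RingOfIntegers E) in Filter.cofinite, SatakeFrobCompatibleAt ι' π.1 σ v) → ∀ (ℓ : ℕ) [Fact ℓ.Prime] (ι : PadicAlgCl ℓ ≃+* ℂ) (ρ : Literature.NumberTheory.GaloisRepresentations.FramedGaloisRep K (PadicAlgCl ℓ) n), ρ.toGaloisRep.IsIrreducible → ((∀ᶠ v : IsDedekindDomain.HeightOneSpectrum (NumberField.RingOfIntegers K) in Filter.cofinite,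 ρ.IsUnramifiedAt v) ∧ ∀ (v : IsDedekindDomain.HeightOneSpectrum (NumberField.RingOfIntegers K)) (hv : ((ℓ : ℕ) : NumberField.RingOfIntegers K) ∈ v.asIdeal), (Literature.NumberTheory.PAdicHodge.fontainePstAdicCompletion v ℓ hv).IsDeRhamFramed (ρ.toLocal v)) → (∀ (L : Type) [Field L] [NumberField L] [Algebra K L], (ρ.restrictField L).toGaloisRep.IsIrreducible) → ¬ (∃ U : Set (Field.absoluteGaloisGroup K), IsOpen U ∧ (1 : Field.absoluteGaloisGroup K) ∈ U ∧ ∀ g ∈ U, ∃ c r : PadicAlgCl ℓ, Literature.NumberTheory.GaloisRepresentations.FramedRep.charpoly ρ g = ∏ j ∈ Finset.range n, (Polynomial.X - Polynomial.C (c * r ^ j))) → ∃ π : Literature.NumberTheory.Automorphic.CuspidalAutomorphicRepData n K hcpt, π.1.IsLAlgebraic ∧ ∀ᶠ v : IsDedekindDomain.HeightOneSpectrum (NumberField.RingOfIntegers K) in Filter.cofinite, SatakeFrobCompatibleAt ι π.1 ρ v := Iff.rfl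

/-! ## 4. THE ITEMS (inlined one-liners over existing tree declarations = childroute.items.json `statement` VERBATIM) -/

/-- KT_low · crux 2 · WEAKER · ATTACKABLE-NOW (closable modulo print: rank-IH for the factors + `Ramakrishnan2000_theoremM` (2,2) /
`KimShahidi2002_functorialProduct_GL2GL3` (2,3),(3,2) + cuspidality of ⊠ from Lie-irreducibility + L-algebraicity of ⊠) — the ATTACKED CONJUNCT.
GIVEN Lie-irreducible automorphy in ranks 2 ≤ m < n, clause (B) for the H-box ρ of rank 3 ≤ n < 8 that are K-RATIONALLY KRONECKER. -/
def LowRankKroneckerTransport : Prop :=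
  ∀ (K : Type) [Field K] [NumberField K] (n : ℕ) (hcpt : Literature.NumberTheory.Automorphic.isCompact_glFiniteIntegralLevel n K), 3 ≤ n → (∀ (m : ℕ), 2 ≤ m → m < n → ∀ (E : Type) [Field E] [NumberField E] (hE : Literature.NumberTheory.Automorphic.isCompact_glFiniteIntegralLevel m E) (ℓ' : ℕ) [Fact ℓ'.Prime] (ι' : PadicAlgCl ℓ' ≃+* ℂ) (σ : Literature.NumberTheory.GaloisRepresentations.FramedGaloisRep E (PadicAlgCl ℓ') m), σ.toGaloisRep.IsIrreducible → ((∀ᶠ v : IsDedekindDomain.HeightOneSpectrum (NumberField.RingOfIntegers E) in Filter.cofinite, σ.IsUnramifiedAt v) ∧ ∀ (v : IsDedekindDomain.HeightOneSpectrum (NumberField.RingOfIntegers E)) (hv : ((ℓ' : ℕ) : NumberField.RingOfIntegers E) ∈ v.asIdeal), (Literature.NumberTheory.PAdicHodge.fontainePstAdicCompletion v ℓ' hv).IsDeRhamFramed (σ.toLocal v)) → (∀ (L : Type) [Field L] [NumberField L] [Algebra E L], (σ.restrictField L).toGaloisRep.IsIrreducible) → ∃ π : Literature.NumberTheory.Automorphic.CuspidalAutomorphicRepData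 m E hE, π.1.IsLAlgebraic ∧ ∀ᶠ v : IsDedekindDomain.HeightOneSpectrum (NumberField.RingOfIntegers E) in Filter.cofinite, SatakeFrobCompatibleAt ι' π.1 σ v) → ∀ (ℓ : ℕ) [Fact ℓ.Prime] (ι : PadicAlgCl ℓ ≃+* ℂ) (ρ : Literature.NumberTheory.GaloisRepresentations.FramedGaloisRep K (PadicAlgCl ℓ) n), ρ.toGaloisRep.IsIrreducible → ((∀ᶠ v : IsDedekindDomain.HeightOneSpectrum (NumberField.RingOfIntegers K) in Filter.cofinite, ρ.IsUnramifiedAt v) ∧ ∀ (v : IsDedekindDomain.HeightOneSpectrum (NumberField.RingOfIntegers K)) (hv : ((ℓ : ℕ) : NumberField.RingOfIntegers K) ∈ v.asIdeal), (Literature.NumberTheory.PAdicHodge.fontainePstAdicCompletion v ℓ hv).IsDeRhamFramed (ρ.toLocal v)) → (∀ (L : Type) [Field L] [NumberField L] [Algebra K L], (ρ.restrictField L).toGaloisRep.IsIrreducible) → ¬ (∃ U : Set (Field.absoluteGaloisGroup K), IsOpen U ∧ (1 : Field.absoluteGaloisGroup K) ∈ U ∧ ∀ g ∈ U, ∃ c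 r : PadicAlgCl ℓ, Literature.NumberTheory.GaloisRepresentations.FramedRep.charpoly ρ g = ∏ j ∈ Finset.range n, (Polynomial.X - Polynomial.C (c * r ^ j))) → ((∃ (a b : ℕ) (ρ₁ : Literature.NumberTheory.GaloisRepresentations.FramedGaloisRep K (PadicAlgCl ℓ) a) (ρ₂ : Literature.NumberTheory.GaloisRepresentations.FramedGaloisRep K (PadicAlgCl ℓ) b), 2 ≤ a ∧ 2 ≤ b ∧ n = a * b ∧ (ρ₁.toGaloisRep.IsIrreducible ∧ ((∀ᶠ v : IsDedekindDomain.HeightOneSpectrum (NumberField.RingOfIntegers K) in Filter.cofinite, ρ₁.IsUnramifiedAt v) ∧ ∀ (v : IsDedekindDomain.HeightOneSpectrum (NumberField.RingOfIntegers K)) (hv : ((ℓ : ℕ) : NumberField.RingOfIntegers K) ∈ v.asIdeal), (Literature.NumberTheory.PAdicHodge.fontainePstAdicCompletion v ℓ hv).IsDeRhamFramed (ρ₁.toLocal v)) ∧ (∀ (L : Type) [Field L] [NumberField L] [Algebra K L], (ρ₁.restrictField L).toGaloisRep.IsIrreducible)) ∧ (ρ₂.toGaloisRep.IsIrreducible ∧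 ((∀ᶠ v : IsDedekindDomain.HeightOneSpectrum (NumberField.RingOfIntegers K) in Filter.cofinite, ρ₂.IsUnramifiedAt v) ∧ ∀ (v : IsDedekindDomain.HeightOneSpectrum (NumberField.RingOfIntegers K)) (hv : ((ℓ : ℕ) : NumberField.RingOfIntegers K) ∈ v.asIdeal), (Literature.NumberTheory.PAdicHodge.fontainePstAdicCompletion v ℓ hv).IsDeRhamFramed (ρ₂.toLocal v)) ∧ (∀ (L : Type) [Field L] [NumberField L] [Algebra K L], (ρ₂.restrictField L).toGaloisRep.IsIrreducible)) ∧ ∀ g : Field.absoluteGaloisGroup K, Literature.NumberTheory.GaloisRepresentations.FramedRep.charpoly ρ g = (Matrix.kroneckerMap (· * ·) ((ρ₁ g : GL (Fin a) (PadicAlgCl ℓ)) : Matrix (Fin a) (Fin a) (PadicAlgCl ℓ)) ((ρ₂ g : GL (Fin b) (PadicAlgCl ℓ)) : Matrix (Fin b) (Fin b) (PadicAlgCl ℓ))).charpoly) ∧ n < 8) → ∃ π : Literature.NumberTheory.Automorphic.CuspidalAutomorphicRepData n K hcpt, π.1.IsLAlgebraic ∧ ∀ᶠ v : IsDedekindDomain.HeightOneSpectrum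 (NumberField.RingOfIntegers K) in Filter.cofinite, SatakeFrobCompatibleAt ι π.1 ρ v

/-- KT_high · crux 3 · WEAKER · IDEA-NEEDED / BARRIER (tensor-product functoriality GL_a × GL_b → GL_ab, ab ≥ 8: OPEN; `TwistedEndoscopySelfDual`
head-on).  GIVEN the rank-IH, clause (B) for the H-box ρ of rank n ≥ 8 that are K-RATIONALLY KRONECKER. -/
def HigherKroneckerTransport : Prop :=
  ∀ (K : Type) [Field K] [NumberField K] (n : ℕ) (hcpt : Literature.NumberTheory.Automorphic.isCompact_glFiniteIntegralLevel n K), 3 ≤ n → (∀ (m : ℕ), 2 ≤ m → m < n → ∀ (E : Type) [Field E] [NumberField E] (hE : Literature.NumberTheory.Automorphic.isCompact_glFiniteIntegralLevel m E) (ℓ' : ℕ) [Fact ℓ'.Prime] (ι' : PadicAlgCl ℓ' ≃+* ℂ) (σ : Literature.NumberTheory.GaloisRepresentations.FramedGaloisRep E (PadicAlgCl ℓ') m), σ.toGaloisRep.IsIrreducible → ((∀ᶠ v : IsDedekindDomain.HeightOneSpectrum (NumberField.RingOfIntegers E) in Filter.cofinite, σ.IsUnramifiedAt v) ∧ ∀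 (v : IsDedekindDomain.HeightOneSpectrum (NumberField.RingOfIntegers E)) (hv : ((ℓ' : ℕ) : NumberField.RingOfIntegers E) ∈ v.asIdeal), (Literature.NumberTheory.PAdicHodge.fontainePstAdicCompletion v ℓ' hv).IsDeRhamFramed (σ.toLocal v)) → (∀ (L : Type) [Field L] [NumberField L] [Algebra E L], (σ.restrictField L).toGaloisRep.IsIrreducible) → ∃ π : Literature.NumberTheory.Automorphic.CuspidalAutomorphicRepData m E hE, π.1.IsLAlgebraic ∧ ∀ᶠ v : IsDedekindDomain.HeightOneSpectrum (NumberField.RingOfIntegers E) in Filter.cofinite, SatakeFrobCompatibleAt ι' π.1 σ v) → ∀ (ℓ : ℕ) [Fact ℓ.Prime] (ι : PadicAlgCl ℓ ≃+* ℂ) (ρ : Literature.NumberTheory.GaloisRepresentations.FramedGaloisRep K (PadicAlgCl ℓ) n), ρ.toGaloisRep.IsIrreducible → ((∀ᶠ v : IsDedekindDomain.HeightOneSpectrum (NumberField.RingOfIntegers K) in Filter.cofinite, ρ.IsUnramifiedAt v) ∧ ∀ (v : IsDedekindDomain.HeightOneSpectrum (NumberField.RingOfIntegers K)) (hv : ((ℓ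 : ℕ) : NumberField.RingOfIntegers K) ∈ v.asIdeal), (Literature.NumberTheory.PAdicHodge.fontainePstAdicCompletion v ℓ hv).IsDeRhamFramed (ρ.toLocal v)) → (∀ (L : Type) [Field L] [NumberField L] [Algebra K L], (ρ.restrictField L).toGaloisRep.IsIrreducible) → ¬ (∃ U : Set (Field.absoluteGaloisGroup K), IsOpen U ∧ (1 : Field.absoluteGaloisGroup K) ∈ U ∧ ∀ g ∈ U, ∃ c r : PadicAlgCl ℓ, Literature.NumberTheory.GaloisRepresentations.FramedRep.charpoly ρ g = ∏ j ∈ Finset.range n, (Polynomial.X - Polynomial.C (c * r ^ j))) → ((∃ (a b : ℕ) (ρ₁ : Literature.NumberTheory.GaloisRepresentations.FramedGaloisRep K (PadicAlgCl ℓ) a) (ρ₂ : Literature.NumberTheory.GaloisRepresentations.FramedGaloisRep K (PadicAlgCl ℓ) b), 2 ≤ a ∧ 2 ≤ b ∧ n = a * b ∧ (ρ₁.toGaloisRep.IsIrreducible ∧ ((∀ᶠ v : IsDedekindDomain.HeightOneSpectrum (NumberField.RingOfIntegers K) in Filter.cofinite, ρ₁.IsUnramifiedAt v) ∧ ∀ (v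 : IsDedekindDomain.HeightOneSpectrum (NumberField.RingOfIntegers K)) (hv : ((ℓ : ℕ) : NumberField.RingOfIntegers K) ∈ v.asIdeal), (Literature.NumberTheory.PAdicHodge.fontainePstAdicCompletion v ℓ hv).IsDeRhamFramed (ρ₁.toLocal v)) ∧ (∀ (L : Type) [Field L] [NumberField L] [Algebra K L], (ρ₁.restrictField L).toGaloisRep.IsIrreducible)) ∧ (ρ₂.toGaloisRep.IsIrreducible ∧ ((∀ᶠ v : IsDedekindDomain.HeightOneSpectrum (NumberField.RingOfIntegers K) in Filter.cofinite, ρ₂.IsUnramifiedAt v) ∧ ∀ (v : IsDedekindDomain.HeightOneSpectrum (NumberField.RingOfIntegers K)) (hv : ((ℓ : ℕ) : NumberField.RingOfIntegers K) ∈ v.asIdeal), (Literature.NumberTheory.PAdicHodge.fontainePstAdicCompletion v ℓ hv).IsDeRhamFramed (ρ₂.toLocal v)) ∧ (∀ (L : Type) [Field L] [NumberField L] [Algebra K L], (ρ₂.restrictField L).toGaloisRep.IsIrreducible)) ∧ ∀ g : Field.absoluteGaloisGroup K, Literature.NumberTheory.GaloisRepresentations.FramedRep.charpoly ρ g = (Matrix.kroneckerMap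 (· * ·) ((ρ₁ g : GL (Fin a) (PadicAlgCl ℓ)) : Matrix (Fin a) (Fin a) (PadicAlgCl ℓ)) ((ρ₂ g : GL (Fin b) (PadicAlgCl ℓ)) : Matrix (Fin b) (Fin b) (PadicAlgCl ℓ))).charpoly) ∧ 8 ≤ n) → ∃ π : Literature.NumberTheory.Automorphic.CuspidalAutomorphicRepData n K hcpt, π.1.IsLAlgebraic ∧ ∀ᶠ v : IsDedekindDomain.HeightOneSpectrum (NumberField.RingOfIntegers K) in Filter.cofinite, SatakeFrobCompatibleAt ι π.1 ρ v

/-- PRIM · crux 4 · WEAKER · DECLARED RESIDUAL · UNDECIDED.  GIVEN the rank-IH, clause (B) for the H-box ρ that are SOLVABLY TENSOR-PRIMITIVE: no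
solvable Galois E/K over which ρ|_E is in the H-box and E-rationally Kronecker ((G°)^der simple — SL_m, Sp, SO, spin, exceptional images — and,
from rank 32 on, non-solvably permuted isotypic factors). -/
def SolvablyTensorPrimitiveAutomorphy : Prop :=
  ∀ (K : Type) [Field K] [NumberField K] (n : ℕ) (hcpt : Literature.NumberTheory.Automorphic.isCompact_glFiniteIntegralLevel n K), 3 ≤ n → (∀ (m : ℕ), 2 ≤ m → m < n → ∀ (E : Type) [Field E] [NumberField E] (hE : Literature.NumberTheory.Automorphic.isCompact_glFiniteIntegralLevel m E) (ℓ' : ℕ) [Fact ℓ'.Prime] (ι' : PadicAlgCl ℓ' ≃+* ℂ) (σ : Literature.NumberTheory.GaloisRepresentations.FramedGaloisRep E (PadicAlgCl ℓ') m), σ.toGaloisRep.IsIrreducible → ((∀ᶠ v : IsDedekindDomain.HeightOneSpectrum (NumberField.RingOfIntegers E) in Filter.cofinite, σ.IsUnramifiedAt v) ∧ ∀ (v : IsDedekindDomain.HeightOneSpectrum (NumberField.RingOfIntegers E)) (hv : ((ℓ' : ℕ) : NumberField.RingOfIntegers E) ∈ v.asIdeal), (Literature.NumberTheory.PAdicHodge.fontainePstAdicCompletion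 v ℓ' hv).IsDeRhamFramed (σ.toLocal v)) → (∀ (L : Type) [Field L] [NumberField L] [Algebra E L], (σ.restrictField L).toGaloisRep.IsIrreducible) → ∃ π : Literature.NumberTheory.Automorphic.CuspidalAutomorphicRepData m E hE, π.1.IsLAlgebraic ∧ ∀ᶠ v : IsDedekindDomain.HeightOneSpectrum (NumberField.RingOfIntegers E) in Filter.cofinite, SatakeFrobCompatibleAt ι' π.1 σ v) → ∀ (ℓ : ℕ) [Fact ℓ.Prime] (ι : PadicAlgCl ℓ ≃+* ℂ) (ρ : Literature.NumberTheory.GaloisRepresentations.FramedGaloisRep K (PadicAlgCl ℓ) n), ρ.toGaloisRep.IsIrreducible → ((∀ᶠ v : IsDedekindDomain.HeightOneSpectrum (NumberField.RingOfIntegers K) in Filter.cofinite, ρ.IsUnramifiedAt v) ∧ ∀ (v : IsDedekindDomain.HeightOneSpectrum (NumberField.RingOfIntegers K)) (hv : ((ℓ : ℕ) : NumberField.RingOfIntegers K) ∈ v.asIdeal), (Literature.NumberTheory.PAdicHodge.fontainePstAdicCompletion v ℓ hv).IsDeRhamFramed (ρ.toLocal v)) → (∀ (L : Type) [Field L] [NumberField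 L] [Algebra K L], (ρ.restrictField L).toGaloisRep.IsIrreducible) → ¬ (∃ U : Set (Field.absoluteGaloisGroup K), IsOpen U ∧ (1 : Field.absoluteGaloisGroup K) ∈ U ∧ ∀ g ∈ U, ∃ c r : PadicAlgCl ℓ, Literature.NumberTheory.GaloisRepresentations.FramedRep.charpoly ρ g = ∏ j ∈ Finset.range n, (Polynomial.X - Polynomial.C (c * r ^ j))) → ¬ (∃ (E : Type) (_ : Field E) (_ : NumberField E) (_ : Algebra K E), IsGalois K E ∧ IsSolvable (E ≃ₐ[K] E) ∧ ((ρ.restrictField E).toGaloisRep.IsIrreducible ∧ ((∀ᶠ v : IsDedekindDomain.HeightOneSpectrum (NumberField.RingOfIntegers E) in Filter.cofinite, (ρ.restrictField E).IsUnramifiedAt v) ∧ ∀ (v : IsDedekindDomain.HeightOneSpectrum (NumberField.RingOfIntegers E)) (hv : ((ℓ : ℕ) : NumberField.RingOfIntegers E) ∈ v.asIdeal), (Literature.NumberTheory.PAdicHodge.fontainePstAdicCompletion v ℓ hv).IsDeRhamFramed ((ρ.restrictField E).toLocal v)) ∧ (∀ (L : Type) [Field L] [NumberField L] [Algebra E L],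 ((ρ.restrictField E).restrictField L).toGaloisRep.IsIrreducible) ∧ ¬ (∃ U : Set (Field.absoluteGaloisGroup E), IsOpen U ∧ (1 : Field.absoluteGaloisGroup E) ∈ U ∧ ∀ g ∈ U, ∃ c r : PadicAlgCl ℓ, Literature.NumberTheory.GaloisRepresentations.FramedRep.charpoly (ρ.restrictField E) g = ∏ j ∈ Finset.range n, (Polynomial.X - Polynomial.C (c * r ^ j)))) ∧ (∃ (a b : ℕ) (ρ₁ : Literature.NumberTheory.GaloisRepresentations.FramedGaloisRep E (PadicAlgCl ℓ) a) (ρ₂ : Literature.NumberTheory.GaloisRepresentations.FramedGaloisRep E (PadicAlgCl ℓ) b), 2 ≤ a ∧ 2 ≤ b ∧ n = a * b ∧ (ρ₁.toGaloisRep.IsIrreducible ∧ ((∀ᶠ v : IsDedekindDomain.HeightOneSpectrum (NumberField.RingOfIntegers E) in Filter.cofinite, ρ₁.IsUnramifiedAt v) ∧ ∀ (v : IsDedekindDomain.HeightOneSpectrum (NumberField.RingOfIntegers E)) (hv : ((ℓ : ℕ) : NumberField.RingOfIntegers E) ∈ v.asIdeal), (Literature.NumberTheory.PAdicHodge.fontainePstAdicCompletion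 v ℓ hv).IsDeRhamFramed (ρ₁.toLocal v)) ∧ (∀ (L : Type) [Field L] [NumberField L] [Algebra E L], (ρ₁.restrictField L).toGaloisRep.IsIrreducible)) ∧ (ρ₂.toGaloisRep.IsIrreducible ∧ ((∀ᶠ v : IsDedekindDomain.HeightOneSpectrum (NumberField.RingOfIntegers E) in Filter.cofinite, ρ₂.IsUnramifiedAt v) ∧ ∀ (v : IsDedekindDomain.HeightOneSpectrum (NumberField.RingOfIntegers E)) (hv : ((ℓ : ℕ) : NumberField.RingOfIntegers E) ∈ v.asIdeal), (Literature.NumberTheory.PAdicHodge.fontainePstAdicCompletion v ℓ hv).IsDeRhamFramed (ρ₂.toLocal v)) ∧ (∀ (L : Type) [Field L] [NumberField L] [Algebra E L], (ρ₂.restrictField L).toGaloisRep.IsIrreducible)) ∧ ∀ g : Field.absoluteGaloisGroup E, Literature.NumberTheory.GaloisRepresentations.FramedRep.charpoly (ρ.restrictField E) g = (Matrix.kroneckerMap (· * ·) ((ρ₁ g : GL (Fin a) (PadicAlgCl ℓ)) : Matrix (Fin a) (Fin a) (PadicAlgCl ℓ)) ((ρ₂ g : GL (Fin b) (PadicAlgCl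 ℓ)) : Matrix (Fin b) (Fin b) (PadicAlgCl ℓ))).charpoly)) → ∃ π : Literature.NumberTheory.Automorphic.CuspidalAutomorphicRepData n K hcpt, π.1.IsLAlgebraic ∧ ∀ᶠ v : IsDedekindDomain.HeightOneSpectrum (NumberField.RingOfIntegers K) in Filter.cofinite, SatakeFrobCompatibleAt ι π.1 ρ v

/-- CSD · support · DEDUP-ATTACH (= `HolomorphicLimitSplit.CliffordSolvableDescent`, stmt-Langlands-31695, VERBATIM; PRINT mod W⁺). -/
def CliffordSolvableDescent : Prop :=
  (∀ (K : Type) [Field K] [NumberField K] (n : ℕ) (hcpt : Literature.NumberTheory.Automorphic.isCompact_glFiniteIntegralLevel n K), 0 < n → ∀ (π : Literature.NumberTheory.Automorphic.CuspidalAutomorphicRepData n K hcpt), π.1.IsLAlgebraic → ∀ (ℓ : ℕ) [Fact ℓ.Prime] (ι : PadicAlgCl ℓ ≃+* ℂ), ∃ ρ : Literature.NumberTheory.GaloisRepresentations.FramedGaloisRep K (PadicAlgCl ℓ) n, ρ.toGaloisRep.IsIrreducible ∧ ∀ᶠ v : IsDedekindDomain.HeightOneSpectrum (NumberField.RingOfIntegers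 K) in Filter.cofinite, SatakeFrobCompatibleAt ι π.1 ρ v) → ∀ (K : Type) [Field K] [NumberField K] (n : ℕ) (ℓ : ℕ) [Fact ℓ.Prime] (ι : PadicAlgCl ℓ ≃+* ℂ) (ρ : Literature.NumberTheory.GaloisRepresentations.FramedGaloisRep K (PadicAlgCl ℓ) n), ρ.toGaloisRep.IsIrreducible → ((∀ᶠ v : IsDedekindDomain.HeightOneSpectrum (NumberField.RingOfIntegers K) in Filter.cofinite, ρ.IsUnramifiedAt v) ∧ ∀ (v : IsDedekindDomain.HeightOneSpectrum (NumberField.RingOfIntegers K)) (hv : ((ℓ : ℕ) : NumberField.RingOfIntegers K) ∈ v.asIdeal), (Literature.NumberTheory.PAdicHodge.fontainePstAdicCompletion v ℓ hv).IsDeRhamFramed (ρ.toLocal v)) → 0 < n → ∀ (E : Type) [Field E] [NumberField E] [Algebra K E], IsGalois K E → IsSolvable (E ≃ₐ[K] E) → ∀ (m : ℕ) (ϑ : Literature.NumberTheory.GaloisRepresentations.FramedGaloisRep E (PadicAlgCl ℓ) m), ϑ.toGaloisRep.IsIrreducible → (∃ (mc : ℕ) (θc : Literature.NumberTheory.GaloisRepresentations.FramedGaloisRep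 E (PadicAlgCl ℓ) mc), ∀ g : Field.absoluteGaloisGroup E, Literature.NumberTheory.GaloisRepresentations.FramedRep.trace (ρ.restrictField E) g = Literature.NumberTheory.GaloisRepresentations.FramedRep.trace ϑ g + Literature.NumberTheory.GaloisRepresentations.FramedRep.trace θc g) → 0 < m → (∀ hcptE : Literature.NumberTheory.Automorphic.isCompact_glFiniteIntegralLevel m E, ∃ π : Literature.NumberTheory.Automorphic.CuspidalAutomorphicRepData m E hcptE, π.1.IsLAlgebraic ∧ ∀ᶠ v : IsDedekindDomain.HeightOneSpectrum (NumberField.RingOfIntegers E) in Filter.cofinite, SatakeFrobCompatibleAt ι π.1 ϑ v) → ∀ hcpt : Literature.NumberTheory.Automorphic.isCompact_glFiniteIntegralLevel n K, ∃ π : Literature.NumberTheory.Automorphic.CuspidalAutomorphicRepData n K hcpt, π.1.IsLAlgebraic ∧ ∀ᶠ v : IsDedekindDomain.HeightOneSpectrum (NumberField.RingOfIntegers K) in Filter.cofinite, SatakeFrobCompatibleAt ι π.1 ρ v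

/-- FRAME · support · the HOST ROUTE below H, as one implication BY NAME. Certified from the host's `closes`, the landed resplit glue and the host
items (`frame_of_host`); trivially from Langlands. -/
def HigherLieRankFrame : Prop :=
  Summit.Langlands.Langlands.Theses.MonodromyDichotomy.HigherLieRankAutomorphy → _root_.Langlands

/-! ## 5. Identity of the items with the structured forms / the tree (`Iff.rfl` ×5) -/

/-- KT_low unfolded (identity with the structured form). -/
theorem lowRankKroneckerTransport_iff : LowRankKroneckerTransport ↔
    ∀ (K : Type) [Field K] [NumberField K] (n : ℕ) (hcpt : Literature.NumberTheory.Automorphic.isCompact_glFiniteIntegralLevel n K), 3 ≤ n → RankIH n →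
      ∀ (ℓ : ℕ) [Fact ℓ.Prime] (ι : PadicAlgCl ℓ ≃+* ℂ) (ρ : Literature.NumberTheory.GaloisRepresentations.FramedGaloisRep K (PadicAlgCl ℓ) n), ρ.toGaloisRep.IsIrreducible → PinnedGeometric ρ →
        IsLieIrreducible ρ → ¬ HasProgressionSpectra ρ → (IsRationalKronecker ρ ∧ n < 8) → WeakAutomorphic hcpt ι ρ := Iff.rfl

/-- KT_high unfolded (identity with the structured form). -/
theorem higherKroneckerTransport_iff : HigherKroneckerTransport ↔
    ∀ (K : Type) [Field K] [NumberField K] (n : ℕ) (hcpt : Literature.NumberTheory.Automorphic.isCompact_glFiniteIntegralLevel n K), 3 ≤ n → RankIH n →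
      ∀ (ℓ : ℕ) [Fact ℓ.Prime] (ι : PadicAlgCl ℓ ≃+* ℂ) (ρ : Literature.NumberTheory.GaloisRepresentations.FramedGaloisRep K (PadicAlgCl ℓ) n), ρ.toGaloisRep.IsIrreducible → PinnedGeometric ρ →
        IsLieIrreducible ρ → ¬ HasProgressionSpectra ρ → (IsRationalKronecker ρ ∧ 8 ≤ n) → WeakAutomorphic hcpt ι ρ := Iff.rfl

/-- PRIM unfolded (identity with the structured form). -/
theorem solvablyTensorPrimitiveAutomorphy_iff : SolvablyTensorPrimitiveAutomorphy ↔
    ∀ (K : Type) [Field K] [NumberField K] (n : ℕ) (hcpt : Literature.NumberTheory.Automorphic.isCompact_glFiniteIntegralLevel n K), 3 ≤ n → RankIH n →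
      ∀ (ℓ : ℕ) [Fact ℓ.Prime] (ι : PadicAlgCl ℓ ≃+* ℂ) (ρ : Literature.NumberTheory.GaloisRepresentations.FramedGaloisRep K (PadicAlgCl ℓ) n), ρ.toGaloisRep.IsIrreducible → PinnedGeometric ρ →
        IsLieIrreducible ρ → ¬ HasProgressionSpectra ρ → ¬ IsSolvablyKronecker ρ → WeakAutomorphic hcpt ι ρ := Iff.rfl

/-- CSD is the tree item, verbatim. -/
theorem cliffordSolvableDescent_iff_tree : CliffordSolvableDescent ↔ HolomorphicLimitSplit.CliffordSolvableDescent := Iff.rfl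

/-- the W⁺ antecedent of CSD is the host's W⁺ item (stmt-Langlands-17415), definitionally. -/
theorem wplus_feeds_csd (hW : MonodromyDichotomy.SatakeAvatarExistence) (hCSD : CliffordSolvableDescent) :
    ∀ (K : Type) [Field K] [NumberField K] (n : ℕ) (ℓ : ℕ) [Fact ℓ.Prime] (ι : PadicAlgCl ℓ ≃+* ℂ) (ρ : Literature.NumberTheory.GaloisRepresentations.FramedGaloisRep K (PadicAlgCl ℓ) n), ρ.toGaloisRep.IsIrreducible → ((∀ᶠ v : IsDedekindDomain.HeightOneSpectrum (NumberField.RingOfIntegers K) in Filter.cofinite, ρ.IsUnramifiedAt v) ∧ ∀ (v : IsDedekindDomain.HeightOneSpectrum (NumberField.RingOfIntegers K)) (hv : ((ℓ : ℕ) : NumberField.RingOfIntegers K) ∈ v.asIdeal), (Literature.NumberTheory.PAdicHodge.fontainePstAdicCompletion v ℓ hv).IsDeRhamFramed (ρ.toLocal v)) → 0 < n → ∀ (E : Type) [Field E] [NumberField E] [Algebra K E], IsGalois K E → IsSolvable (E ≃ₐ[K] E) → ∀ (m : ℕ) (ϑ : Literature.NumberTheory.GaloisRepresentations.FramedGaloisRep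 E (PadicAlgCl ℓ) m), ϑ.toGaloisRep.IsIrreducible → (∃ (mc : ℕ) (θc : Literature.NumberTheory.GaloisRepresentations.FramedGaloisRep E (PadicAlgCl ℓ) mc), ∀ g : Field.absoluteGaloisGroup E, Literature.NumberTheory.GaloisRepresentations.FramedRep.trace (ρ.restrictField E) g = Literature.NumberTheory.GaloisRepresentations.FramedRep.trace ϑ g + Literature.NumberTheory.GaloisRepresentations.FramedRep.trace θc g) → 0 < m → (∀ hcptE : Literature.NumberTheory.Automorphic.isCompact_glFiniteIntegralLevel m E, ∃ π : Literature.NumberTheory.Automorphic.CuspidalAutomorphicRepData m E hcptE, π.1.IsLAlgebraic ∧ ∀ᶠ v : IsDedekindDomain.HeightOneSpectrum (NumberField.RingOfIntegers E) in Filter.cofinite, SatakeFrobCompatibleAt ι π.1 ϑ v) → ∀ hcpt : Literature.NumberTheory.Automorphic.isCompact_glFiniteIntegralLevel n K, ∃ π : Literature.NumberTheory.Automorphic.CuspidalAutomorphicRepData n K hcpt, π.1.IsLAlgebraic ∧ ∀ᶠ v : IsDedekindDomain.HeightOneSpectrum (NumberField.RingOfIntegers K) in Filter.cofinite, SatakeFrobCompatibleAt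 ι π.1 ρ v := hCSD hW

/-! ## 6. Kernels -/

/-- H ⟹ each cell (every cell is H with ONE extra hypothesis): OUTRIGHT. -/
theorem cells_of_higherLieRank (hH : MonodromyDichotomy.HigherLieRankAutomorphy) :
    LowRankKroneckerTransport ∧ HigherKroneckerTransport ∧ SolvablyTensorPrimitiveAutomorphy :=
  ⟨fun K _ _ n hcpt h3 hIH ℓ _ ι ρ hirr hgeo hLie hPS _ => hH K n hcpt h3 hIH ℓ ι ρ hirr hgeo hLie hPS,
   fun K _ _ n hcpt h3 hIH ℓ _ ι ρ hirr hgeo hLie hPS _ => hH K n hcpt h3 hIH ℓ ι ρ hirr hgeo hLie hPS,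
   fun K _ _ n hcpt h3 hIH ℓ _ ι ρ hirr hgeo hLie hPS _ => hH K n hcpt h3 hIH ℓ ι ρ hirr hgeo hLie hPS⟩

/-- the rank-0 complement: `tr ρ|_E = tr ρ|_E + tr 𝟙₀` (CSD is applied with ϑ := ρ|_E itself). -/
theorem trace_restrictField_eq_add_zero {K : Type} [Field K] {ℓ : ℕ} [Fact ℓ.Prime] {n : ℕ} (ρ : Literature.NumberTheory.GaloisRepresentations.FramedGaloisRep K (PadicAlgCl ℓ) n)
    (E : Type) [Field E] [Algebra K E] :
    ∃ (mc : ℕ) (θc : Literature.NumberTheory.GaloisRepresentations.FramedGaloisRep E (PadicAlgCl ℓ) mc), ∀ g : Field.absoluteGaloisGroup E,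
      Literature.NumberTheory.GaloisRepresentations.FramedRep.trace (ρ.restrictField E) g = Literature.NumberTheory.GaloisRepresentations.FramedRep.trace (ρ.restrictField E) g + Literature.NumberTheory.GaloisRepresentations.FramedRep.trace θc g :=
  ⟨0, 1, fun g => by rw [show Literature.NumberTheory.GaloisRepresentations.FramedRep.trace (1 : Literature.NumberTheory.GaloisRepresentations.FramedGaloisRep E (PadicAlgCl ℓ) 0) g = 0 from Matrix.trace_eq_zero_of_isEmpty _, add_zero]⟩

/-- **the cells ⟹ H modulo (W⁺ ∧ CSD)**: excluded middle on the SOLVABLE Kronecker dial; on the Kronecker side run KT over E on ρ|_E (rank < 8: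
KT_low, rank ≥ 8: KT_high; the rank-IH is field-universal and passes through) and descend the weak automorphy E → K by CSD fed with W⁺
(ϑ := ρ|_E, rank-0 complement); on the primitive side PRIM is H verbatim.  (= `childroute.glue.lean`'s body.) -/
theorem higherLieRank_of_cells (hW : MonodromyDichotomy.SatakeAvatarExistence) (hCSD : CliffordSolvableDescent)
    (hlow : LowRankKroneckerTransport) (hhigh : HigherKroneckerTransport) (hprim : SolvablyTensorPrimitiveAutomorphy) :
    MonodromyDichotomy.HigherLieRankAutomorphy := by
  intro K _ _ n hcpt h3 hIH ℓ _ ι ρ hirr hgeo hLie hPS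
  by_cases hd : IsSolvablyKronecker ρ
  · obtain ⟨E, _, _, _, hGal, hSolv, ⟨hirrE, hgeoE, hLieE, hPSE⟩, hKr⟩ := hd
    have hn : 0 < n := by omega
    have autE : ∀ hcptE : Literature.NumberTheory.Automorphic.isCompact_glFiniteIntegralLevel n E, WeakAutomorphic hcptE ι (ρ.restrictField E) := by
      intro hcptE
      by_cases h8 : n < 8
      · exact hlow E n hcptE h3 hIH ℓ ι (ρ.restrictField E) hirrE hgeoE hLieE hPSE ⟨hKr, h8⟩
      · exact hhigh E n hcptE h3 hIH ℓ ι (ρ.restrictField E) hirrE hgeoE hLieE hPSE ⟨hKr, by omega⟩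
    exact hCSD hW K n ℓ ι ρ hirr hgeo hn E hGal hSolv n (ρ.restrictField E) hirrE (trace_restrictField_eq_add_zero ρ E) hn autE hcpt
  · exact hprim K n hcpt h3 hIH ℓ ι ρ hirr hgeo hLie hPS hd

/-- **EXACTNESS**: modulo (W⁺ ∧ CSD), H ⟺ KT_low ∧ KT_high ∧ PRIM (and ⟹ holds outright, `cells_of_higherLieRank`). -/
theorem higherLieRank_iff_cells (hW : MonodromyDichotomy.SatakeAvatarExistence) (hCSD : CliffordSolvableDescent) :
    MonodromyDichotomy.HigherLieRankAutomorphy ↔ LowRankKroneckerTransport ∧ HigherKroneckerTransport ∧ SolvablyTensorPrimitiveAutomorphy :=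
  ⟨cells_of_higherLieRank, fun h => higherLieRank_of_cells hW hCSD h.1 h.2.1 h.2.2⟩

/-- **THE FRAME IS THE HOST ROUTE**: the host items R1, SpecialCell, GEN, SYM, S1, T, S2, W⁺, P, L∤R, CRD (BY NAME) ⟹ (H → Langlands), through the
LANDED resplit glue `Theorems.LieIrreducibleAutomorphy_of_resplit_proof` (item 31223, CLOSED) and the host's certified `MonodromyDichotomy.closes`. -/
theorem frame_of_host (h1 : MonodromyDichotomy.RankOneAutomorphy) (hSP : MonodromyDichotomy.SpecialCellAutomorphy)
    (hGE : MonodromyDichotomy.GenericModuliAutomorphy) (hSYM : MonodromyDichotomy.SymmetricPowerTransport)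
    (hS : MonodromyDichotomy.ArtinTypeAutomorphy) (hT : MonodromyDichotomy.CliffordTateStructure) (hX : MonodromyDichotomy.StructuredTransport)
    (hW : MonodromyDichotomy.SatakeAvatarExistence) (hP : MonodromyDichotomy.PadicMemberCompatibility)
    (hA : MonodromyDichotomy.CompatibilityAwayFromLR) (hR : MonodromyDichotomy.CanonicalReciprocityData) : HigherLieRankFrame := fun hH =>
  MonodromyDichotomy.closes h1 (Summit.Langlands.Langlands.Theorems.LieIrreducibleAutomorphy_of_resplit_proof hSP hGE hSYM hH) hS hT hX hW hP hA hR

/-- the frame is (trivially) implied by the summit. -/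
theorem frame_of_langlands (h : _root_.Langlands) : HigherLieRankFrame := fun _ => h

/-- NECESSITY: H is implied by the summit (clause (B) at a reciprocity datum, conjunct 1 of `Corresponds`). -/
theorem higherLieRank_of_langlands (h : _root_.Langlands) : MonodromyDichotomy.HigherLieRankAutomorphy := by
  intro K _ _ n hcpt h3 _ ℓ _ ι ρ hirr hgeo _ _
  obtain ⟨⟨𝓡⟩, h𝓡⟩ := h K
  obtain ⟨π, hL, hcorr⟩ := (h𝓡 𝓡 n (by omega) hcpt).2 ℓ ι ρ hirr hgeo
  exact ⟨π, hL, hcorr.1⟩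

/-- … hence so is every NEW cell (no strengthening anywhere). -/
theorem lowRankKroneckerTransport_of_langlands (h : _root_.Langlands) : LowRankKroneckerTransport :=
  (cells_of_higherLieRank (higherLieRank_of_langlands h)).1
/-- Necessity: `Langlands` ⟹ KT_high. -/
theorem higherKroneckerTransport_of_langlands (h : _root_.Langlands) : HigherKroneckerTransport :=
  (cells_of_higherLieRank (higherLieRank_of_langlands h)).2.1
/-- Necessity: `Langlands` ⟹ PRIM. -/
theorem solvablyTensorPrimitiveAutomorphy_of_langlands (h : _root_.Langlands) : SolvablyTensorPrimitiveAutomorphy :=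
  (cells_of_higherLieRank (higherLieRank_of_langlands h)).2.2

/-- W⁺ is implied by the summit (clause (A): an IRREDUCIBLE avatar with a.e. Satake compatibility). -/
theorem wplus_of_langlands (h : _root_.Langlands) : MonodromyDichotomy.SatakeAvatarExistence := by
  intro K _ _ n hcpt hn π hπ ℓ _ ι
  obtain ⟨⟨𝓡⟩, h𝓡⟩ := h K
  obtain ⟨ρ, hirr, _, hcorr, _⟩ := (h𝓡 𝓡 n hn hcpt).1 π hπ ℓ ι
  exact ⟨ρ, hirr, hcorr.1⟩

/-- CSD is implied by the summit (its conclusion is clause (B) for ρ over K; the descent hypotheses are not needed). -/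
theorem cliffordSolvableDescent_of_langlands (h : _root_.Langlands) : CliffordSolvableDescent := by
  intro _ K _ _ n ℓ _ ι ρ hirr hgeo hn E _ _ _ _ _ m ϑ _ _ _ _ hcpt
  obtain ⟨⟨𝓡⟩, h𝓡⟩ := h K
  obtain ⟨π, hL, hcorr⟩ := (h𝓡 𝓡 n hn hcpt).2 ℓ ι ρ hirr hgeo
  exact ⟨π, hL, hcorr.1⟩

/-- **DECIDING THEOREM of the child route** (= `childroute.glue.lean` VERBATIM up to the frame application): the three cells, CSD, W⁺ and the
frame ⟹ `_root_.Langlands` BY NAME. -/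
theorem closes (hlow : LowRankKroneckerTransport) (hhigh : HigherKroneckerTransport) (hprim : SolvablyTensorPrimitiveAutomorphy)
    (hCSD : CliffordSolvableDescent) (hW : MonodromyDichotomy.SatakeAvatarExistence) (hF : HigherLieRankFrame) : _root_.Langlands :=
  hF (higherLieRank_of_cells hW hCSD hlow hhigh hprim)

/-- the deciding theorem with the HOST ITEMS in place of the frame (what the child route decides, spelled over the host route's open items). -/
theorem closes_host_shape (h1 : MonodromyDichotomy.RankOneAutomorphy) (hSP : MonodromyDichotomy.SpecialCellAutomorphy)
    (hGE : MonodromyDichotomy.GenericModuliAutomorphy) (hSYM : MonodromyDichotomy.SymmetricPowerTransport)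
    (hS : MonodromyDichotomy.ArtinTypeAutomorphy) (hT : MonodromyDichotomy.CliffordTateStructure) (hX : MonodromyDichotomy.StructuredTransport)
    (hW : MonodromyDichotomy.SatakeAvatarExistence) (hP : MonodromyDichotomy.PadicMemberCompatibility)
    (hA : MonodromyDichotomy.CompatibilityAwayFromLR) (hR : MonodromyDichotomy.CanonicalReciprocityData)
    (hlow : LowRankKroneckerTransport) (hhigh : HigherKroneckerTransport) (hprim : SolvablyTensorPrimitiveAutomorphy)
    (hCSD : CliffordSolvableDescent) : _root_.Langlands :=
  closes hlow hhigh hprim hCSD hW (frame_of_host h1 hSP hGE hSYM hS hT hX hW hP hA hR)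

/-- **EXACTNESS of the child route, mod NOTHING**: Langlands ⟺ (KT_low ∧ KT_high ∧ PRIM) ∧ CSD ∧ W⁺ ∧ FRAME. -/
theorem langlands_iff_pieces : _root_.Langlands ↔
    (LowRankKroneckerTransport ∧ HigherKroneckerTransport ∧ SolvablyTensorPrimitiveAutomorphy) ∧ CliffordSolvableDescent ∧
      MonodromyDichotomy.SatakeAvatarExistence ∧ HigherLieRankFrame :=
  ⟨fun h => ⟨cells_of_higherLieRank (higherLieRank_of_langlands h), cliffordSolvableDescent_of_langlands h, wplus_of_langlands h,
      frame_of_langlands h⟩,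
   fun h => closes h.1.1 h.1.2.1 h.1.2.2 h.2.1 h.2.2.1 h.2.2.2⟩

/-- the rank-IH every cell carries is itself implied by the summit (no cell is vacuously true under Langlands by a false antecedent). -/
theorem rankIH_of_langlands (h : _root_.Langlands) (n : ℕ) : RankIH n := by
  intro m hm _ E _ _ hE ℓ' _ ι' σ hirr hgeo _
  obtain ⟨⟨𝓡⟩, h𝓡⟩ := h E
  obtain ⟨π, hL, hcorr⟩ := (h𝓡 𝓡 m (by omega) hE).2 ℓ' ι' σ hirr hgeo
  exact ⟨π, hL, hcorr.1⟩

end Summit.Langlands.Langlands.Theorems.MonodromyDichotomyKroneckerPrimitivity
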